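import Literature.Analysis.FluidPDE.HardSphereTorusMeasure
import Literature.MathematicalPhysics.KineticTheory.HardSphereEulerProofs
import HarnessLib

/-!
# `JParityClosure.CollisionTightness` (stmt-AtomisticToContinuum-13085), rung 0, step 2:
# minimal-image lifts and the insertion bound for the hard-sphere gas on `𝕋³`

Helper file (`--supports stmt-AtomisticToContinuum-13085`).  Two measure-theoretic inputs of the
window bound for the mean collision number of `N + 1` hard spheres of diameter `ε` on `𝕋³` under a
homogeneous Gibbs law:

* `volume_setOf_exists_reprSym_add_latticeVec_mem_le` — **Haar versus Lebesgue through the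
  minimal image**: for measurable `B ⊆ ℝ³`, the Haar measure of
  `{x ∈ 𝕋³ | ∃ k ∈ ℤ³, reprSym (x − y) + k ∈ B}` is at most `vol B` (`reprSym` pushes Haar measure
  to Lebesgue measure on the cube `(-1/2, 1/2]³`, `Torus.volume_reprSym_sub_mem`, and the integer
  translates of the half-open cube are disjoint, `disjoint_symCube_translates`);
* `volume_posDomain_succ_ge` — **the insertion bound**: removing one labelled sphere,
  `vol (posDomain ε (N+1)) ≥ (1 − N · vol B_ε) · vol (posDomain ε N)` (a configuration of `N`
  non-overlapping centres extends by any centre outside the `N` excluded balls; union bound), the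
  finite-`N` form of the low-density bound `Ξ(m+1) ≥ Ξ(m)(1 − m p_ε)` of
  `HardSphereCanonicalTorus.Xi_succ_ge`, here for the Haar reference measure;
* `posPartition_const` — for a constant activity `a`, `Z_pos = aⁿ · vol (posDomain ε n)`.

References: H. Spohn, *Large Scale Dynamics of Interacting Particles* (1991), Part I §2.2;
E. Pulvirenti, D. Tsagkarogiannis, Comm. Math. Phys. 316 (2012) 289–306, §4.
-/

noncomputable section

open MeasureTheory Set Filter Topology
open scoped ENNReal

namespace Summit.AtomisticToContinuum.HydrodynamicLimit.Theorems

open Literature.Analysis.FluidPDE Literature.MathematicalPhysics.KineticTheory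
open Literature.Analysis.FunctionSpaces

/-! ### Haar versus Lebesgue through the minimal image -/

/-- The integer translates `(-1/2, 1/2]³ + k` of the half-open symmetric cube are pairwise
disjoint. [folklore] -/
theorem disjoint_symCube_translates {k l : Fin 3 → ℤ} (hkl : k ≠ l) :
    Disjoint ((fun r : V3 => r - Torus.latticeVec k) ⁻¹' Torus.symCube (Fin 3))
      ((fun r : V3 => r - Torus.latticeVec l) ⁻¹' Torus.symCube (Fin 3)) := by
  rw [Set.disjoint_left]
  intro r hk hl
  apply hkl
  funext i
  have h1 := hk i
  have h2 := hl i
  simp only [PiLp.sub_apply, Torus.latticeVec_apply, mem_Ioc] at h1 h2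
  have h3 : |((k i - l i : ℤ) : ℝ)| < 1 := by
    rw [Int.cast_sub, abs_lt]
    constructor <;> linarith [h1.1, h1.2, h2.1, h2.2]
  have h4 : |k i - l i| < 1 := by exact_mod_cast h3
  rw [Int.abs_lt_one_iff, sub_eq_zero] at h4
  exact h4

/-- **Haar versus Lebesgue through the minimal image**: for measurable `B ⊆ ℝ³` and `y ∈ 𝕋³`, the
Haar measure of `{x | ∃ k ∈ ℤ³, reprSym (x − y) + k ∈ B}` (the points of the torus one of whose lifts
relative to `y` lies in `B`) is at most the Lebesgue measure of `B`. [folklore] -/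
theorem volume_setOf_exists_reprSym_add_latticeVec_mem_le (y : T3) {B : Set V3}
    (hB : MeasurableSet B) :
    volume {x : T3 | ∃ k : Fin 3 → ℤ, Torus.reprSym (x - y) + Torus.latticeVec k ∈ B} ≤
      volume B := by
  set pre : (Fin 3 → ℤ) → Set V3 := fun k => (fun r : V3 => r + Torus.latticeVec k) ⁻¹' B
    with hpre
  set Q : Set V3 := Torus.symCube (Fin 3) with hQ
  set Qk : (Fin 3 → ℤ) → Set V3 := fun k => (fun r : V3 => r - Torus.latticeVec k) ⁻¹' Q
    with hQk
  have hprem : ∀ k, MeasurableSet (pre k) := fun k => hB.preimage (measurable_add_const _)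
  have hQm : MeasurableSet Q := Torus.measurableSet_symCube
  have hQkm : ∀ k, MeasurableSet (Qk k) := fun k => hQm.preimage (measurable_sub_const _)
  have hset : {x : T3 | ∃ k : Fin 3 → ℤ, Torus.reprSym (x - y) + Torus.latticeVec k ∈ B} =
      {x : T3 | Torus.reprSym (x - y) ∈ ⋃ k, pre k} := by
    ext x
    simp only [mem_setOf_eq, mem_iUnion, hpre, mem_preimage]
  have htrans : ∀ k, volume (pre k ∩ Q) = volume (B ∩ Qk k) := by
    intro k
    have h1 : pre k ∩ Q = (fun r : V3 => r + Torus.latticeVec k) ⁻¹' (B ∩ Qk k) := by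
      ext r
      simp only [hpre, hQk, mem_inter_iff, mem_preimage, add_sub_cancel_right]
    rw [h1, measure_preimage_add_right]
  have hdisj : Pairwise (Function.onFun Disjoint fun k => B ∩ Qk k) := by
    intro k l hkl
    exact (disjoint_symCube_translates hkl).mono inter_subset_right inter_subset_right
  calc volume {x : T3 | ∃ k : Fin 3 → ℤ, Torus.reprSym (x - y) + Torus.latticeVec k ∈ B}
      = volume ((⋃ k, pre k) ∩ Q) := by
        rw [hset, Torus.volume_reprSym_sub_mem y (MeasurableSet.iUnion hprem)]
    _ = volume (⋃ k, pre k ∩ Q) := by rw [iUnion_inter]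
    _ ≤ ∑' k, volume (pre k ∩ Q) := measure_iUnion_le _
    _ = ∑' k, volume (B ∩ Qk k) := by simp_rw [htrans]
    _ = volume (⋃ k, B ∩ Qk k) := (measure_iUnion hdisj fun k => hB.inter (hQkm k)).symm
    _ ≤ volume B := measure_mono (iUnion_subset fun k => inter_subset_left)

/-! ### The insertion bound -/

/-- The Haar measure of the set of centres at minimal-image distance `≥ ε` from each of `N` given
centres is at least `1 − N · vol B_ε` (`ε < 1/2`; union bound). [folklore] -/
theorem volume_forall_le_euclidDist_ge {ε : ℝ} (hε : ε < 1 / 2) {N : ℕ} (x' : Fin N → T3) :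
    1 - N * volume (Metric.ball (0 : V3) ε) ≤
      volume {y : T3 | ∀ k, ε ≤ Torus.euclidDist y (x' k)} := by
  have hcont : ∀ k, Continuous fun y : T3 => Torus.euclidDist y (x' k) := fun k => by
    have h1 := (Torus.continuous_norm_reprSym (d := Fin 3)).comp (continuous_sub_right (x' k))
    simpa only [Function.comp_def, Torus.euclidDist] using h1
  have hset : {y : T3 | ∀ k, ε ≤ Torus.euclidDist y (x' k)} =
      (⋃ k, {y : T3 | Torus.euclidDist y (x' k) < ε})ᶜ := by
    ext y
    simp only [mem_setOf_eq, compl_iUnion, mem_iInter, mem_compl_iff, not_lt]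
  have hm : MeasurableSet (⋃ k, {y : T3 | Torus.euclidDist y (x' k) < ε}) :=
    MeasurableSet.iUnion fun k => measurableSet_lt (hcont k).measurable measurable_const
  rw [hset, prob_compl_eq_one_sub hm]
  refine tsub_le_tsub_left ?_ _
  calc volume (⋃ k, {y : T3 | Torus.euclidDist y (x' k) < ε})
      ≤ ∑ k, volume {y : T3 | Torus.euclidDist y (x' k) < ε} := measure_iUnion_fintype_le _ _
    _ = ∑ _k : Fin N, volume (Metric.ball (0 : V3) ε) :=
        Finset.sum_congr rfl fun k _ => Torus.volume_euclidDist_lt hε (x' k)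
    _ = N * volume (Metric.ball (0 : V3) ε) := by simp

/-- **The insertion bound.** For `ε < 1/2` and every label `i`, the Haar measure of the non-overlap
set of `N + 1` centres is at least `(1 − N · vol B_ε)` times that of `N` centres: the `N + 1`
centres do not overlap as soon as the centres other than `i` do not and `xᵢ` avoids the `N`
excluded balls around them (Fubini over `xᵢ` first, `measurePreserving_piFinSuccAbove`, and the
union bound `volume_forall_le_euclidDist_ge`). [folklore] -/
theorem volume_posDomain_succ_ge {ε : ℝ} (hε : ε < 1 / 2) (N : ℕ) (i : Fin (N + 1)) :
    (1 - N * volume (Metric.ball (0 : V3) ε)) * volume (posDomain ε N) ≤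
      volume (posDomain ε (N + 1)) := by
  have hmp : MeasurePreserving (MeasurableEquiv.piFinSuccAbove (fun _ : Fin (N + 1) => T3) i)
      volume volume :=
    volume_preserving_piFinSuccAbove (fun _ : Fin (N + 1) => T3) i
  have hvol : (volume : Measure (T3 × (Fin N → T3))) = (volume : Measure T3).prod volume := rfl
  -- the product-side set
  obtain ⟨P, hP⟩ : ∃ P : Set (T3 × (Fin N → T3)),
      P = {p | p.2 ∈ posDomain ε N ∧ ∀ k, ε ≤ Torus.euclidDist p.1 (p.2 k)} := ⟨_, rfl⟩
  have hPm : MeasurableSet P := by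
    have hA : MeasurableSet {p : T3 × (Fin N → T3) | p.2 ∈ posDomain ε N} :=
      (measurableSet_posDomain ε N).preimage measurable_snd
    have hB : MeasurableSet {p : T3 × (Fin N → T3) | ∀ k, ε ≤ Torus.euclidDist p.1 (p.2 k)} := by
      have : {p : T3 × (Fin N → T3) | ∀ k, ε ≤ Torus.euclidDist p.1 (p.2 k)} =
          ⋂ k, {p | ε ≤ Torus.euclidDist p.1 (p.2 k)} := by
        ext p
        simp only [mem_setOf_eq, mem_iInter]
      rw [this]
      refine MeasurableSet.iInter fun k => measurableSet_le measurable_const ?_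
      have h1 : Measurable fun p : T3 × (Fin N → T3) => p.1 - p.2 k :=
        measurable_fst.sub ((measurable_pi_apply k).comp measurable_snd)
      exact (Torus.measurable_reprSym.comp h1).norm
    have hPeq : P = {p : T3 × (Fin N → T3) | p.2 ∈ posDomain ε N} ∩
        {p | ∀ k, ε ≤ Torus.euclidDist p.1 (p.2 k)} := by
      rw [hP]
      ext p
      simp only [mem_setOf_eq, mem_inter_iff]
    rw [hPeq]
    exact hA.inter hB
  -- `e ⁻¹' P ⊆ posDomain ε (N+1)`
  have hsub : MeasurableEquiv.piFinSuccAbove (fun _ : Fin (N + 1) => T3) i ⁻¹' P ⊆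
      posDomain ε (N + 1) := by
    intro x hx
    rw [mem_preimage, hP, mem_setOf_eq] at hx
    obtain ⟨h1, h2⟩ := hx
    have hxi : ∀ k : Fin N, ε ≤ Torus.euclidDist (x i) (x (i.succAbove k)) := h2
    have hoth : ∀ a b : Fin N, a ≠ b →
        ε ≤ Torus.euclidDist (x (i.succAbove a)) (x (i.succAbove b)) := fun a b hab => h1 a b hab
    intro a b hab
    by_cases ha : a = i
    · subst ha
      obtain ⟨b', rfl⟩ := Fin.exists_succAbove_eq (Ne.symm hab)
      exact hxi b'
    · obtain ⟨a', rfl⟩ := Fin.exists_succAbove_eq ha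
      by_cases hb : b = i
      · subst hb
        rw [Torus.euclidDist_comm]
        exact hxi a'
      · obtain ⟨b', rfl⟩ := Fin.exists_succAbove_eq hb
        exact hoth a' b' fun h => hab (by rw [h])
  -- measure of `P` by Fubini
  have hPvol : (1 - N * volume (Metric.ball (0 : V3) ε)) * volume (posDomain ε N) ≤
      (volume : Measure (T3 × (Fin N → T3))) P := by
    rw [hvol, Measure.prod_apply_symm hPm]
    have hfib : ∀ x' : Fin N → T3,
        (posDomain ε N).indicator (fun _ => 1 - N * volume (Metric.ball (0 : V3) ε)) x' ≤
          volume ((fun y : T3 => (y, x')) ⁻¹' P) := by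
      intro x'
      by_cases hx' : x' ∈ posDomain ε N
      · rw [indicator_of_mem hx']
        have : (fun y : T3 => (y, x')) ⁻¹' P = {y : T3 | ∀ k, ε ≤ Torus.euclidDist y (x' k)} := by
          ext y
          simp [hP, hx']
        rw [this]
        exact volume_forall_le_euclidDist_ge hε x'
      · rw [indicator_of_notMem hx']
        exact bot_le
    calc (1 - N * volume (Metric.ball (0 : V3) ε)) * volume (posDomain ε N)
        = ∫⁻ x', (posDomain ε N).indicator
            (fun _ => 1 - N * volume (Metric.ball (0 : V3) ε)) x' := by
          rw [lintegral_indicator_const (measurableSet_posDomain ε N)]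
      _ ≤ ∫⁻ x', volume ((fun y : T3 => (y, x')) ⁻¹' P) := lintegral_mono hfib
  calc (1 - N * volume (Metric.ball (0 : V3) ε)) * volume (posDomain ε N)
      ≤ (volume : Measure (T3 × (Fin N → T3))) P := hPvol
    _ = volume (MeasurableEquiv.piFinSuccAbove (fun _ : Fin (N + 1) => T3) i ⁻¹' P) :=
        (hmp.measure_preimage hPm.nullMeasurableSet).symm
    _ ≤ volume (posDomain ε (N + 1)) := measure_mono hsub

/-- For a constant activity `a`, the position weight is `aⁿ 𝟙_{no overlap}`. [folklore] -/
theorem posWeight_const (a ε : ℝ) (n : ℕ) (x : Fin n → T3) :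
    posWeight (fun _ => a) ε n x = (posDomain ε n).indicator (fun _ => a ^ n) x := by
  unfold posWeight
  by_cases hx : x ∈ posDomain ε n
  · rw [indicator_of_mem hx, indicator_of_mem hx, Finset.prod_const, Finset.card_univ,
      Fintype.card_fin]
  · rw [indicator_of_notMem hx, indicator_of_notMem hx]

/-- **For a constant activity `a`, `Z_pos = aⁿ · vol (posDomain ε n)`.** [folklore] -/
theorem posPartition_const (a ε : ℝ) (n : ℕ) :
    posPartition (fun _ => a) ε n = a ^ n * (volume (posDomain ε n)).toReal := by
  unfold posPartition
  simp_rw [posWeight_const]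
  rw [integral_indicator_const _ (measurableSet_posDomain ε n), smul_eq_mul, mul_comm]
  rfl

end Summit.AtomisticToContinuum.HydrodynamicLimit.Theorems

end
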